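import Literature.NumberTheory.EllipticCurves.ShaRestrictionJZeroInvariants
import Literature.NumberTheory.EllipticCurves.IsogenyRationalCMProofs
import Literature.NumberTheory.EllipticCurves.ShaIsogenyProofs
import Literature.NumberTheory.EllipticCurves.SelmerCorankProofs
import HarnessLib

/-!
# The CM operator `[ω]` on `H¹(K, E[n])` and `Sel_n(E_K/K)` for `j = 0` short models

Finite-level companion of the (WRAP-𝒪)/(WRAP-σ) bricks (`Ш(E_K/K)[2^∞]` as a `ℤ[ω]`-module with a
semilinear involution): for `E = W/ℚ` with `a₁ = … = a₄ = 0` (`y² = x³ + b`), a number field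
`K ∋ ζ` with `ζ` a primitive cube root of unity, `σ ∈ Aut(K/ℚ)` with `σ ζ = ζ²`, and ANY `n : ℤ`:

* `JZero.exists_cm_isogeny_of_eq` — the `K`-rational isogeny `[ζ] : (x, y) ↦ (ζ² x, y)` of the short
  model (`IsogenyRationalCMProofs.exists_isogeny_apply_eq_of_pow_four_mul_eq_of_pow_six_mul_eq`)
  with `[ζ]² + [ζ] + 1 = 0` on `E(K̄)`;
* `torsionH1ToH1_resH1Hom_id`, `resH1Hom_id_apply_apply_add`, `resH1Hom_id_mem_selmerLocalKer`,
  `resH1Hom_id_mem_selmerGroup`, `IsLiftOfAut.conjH1_resH1Hom_id` — generic functoriality of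
  `H¹(K, E[n])` in a `Γ_K`-equivariant endomorphism of `E[n]` (compatibility with
  `H¹(K, E[n]) → H¹(K, E)`, transfer of the relation `f² + f + 1 = 0`, preservation of the Selmer
  local conditions given local points maps, and the commutation rule with the action of a lift);
* `JZero.exists_cm_operator_galH1Torsion` — the package on the tree's objects: an operator
  `w = [ω]_*` on `galH1Torsion (W.baseChange K) n = H¹(K, E_K[n])` with `w² + w + 1 = 0`, lying over
  `H¹([ζ])` on `H¹(K, E_K)`, preserving `selmerGroup (W.baseChange K) n`, and SEMILINEAR for the
  tree's `conjAct W σ n`: `σ_* w = w² σ_*`, i.e. `σ_* (w x) = −σ_* x − w (σ_* x)` — exactly the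
  hypotheses `(w, hw, hσw)` of LEMMA D (`descent_bijective`) for `M = Sel_n(E_K/K)`, `n = 2^M`.

Everything is proved; no new definitions (the operators are built inside the proofs from
`resH1Hom (id) (restriction of [ζ] to E[n])`).

## References

* J.-P. Serre, *Galois Cohomology* (1997), I.§2.4 (functoriality of `H¹`), I.§5.8.
  [SerreGaloisCohomology1997]
* J. S. Milne, *Arithmetic Duality Theorems*, 2nd ed. (2006), I.§6 (Selmer conditions and isogenies).
  [MilneADT2006]
* B. H. Gross, Kolyvagin's work on modular elliptic curves (1991), §5 (5.1). [GrossLMS1991]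
* J. H. Silverman, *The Arithmetic of Elliptic Curves*, 2nd ed. (2009), III.10.1, X.§4.
  [SilvermanAEC2009]
-/

noncomputable section

open scoped Classical

universe u

namespace Literature.NumberTheory.EllipticCurves

open GaloisRepresentations WeierstrassCurve

/-! ## The `[ζ]`-isogeny of a `j = 0` short model with its relation -/

namespace JZero

/-- **The `[ζ]`-isogeny.** For `V = ⟨0, 0, 0, 0, B⟩` elliptic over a field `k` of characteristic
`0` containing a primitive cube root of unity `ζ`: a `k`-isogeny `φ : V → V` with
`φ (x, y) = (ζ² x, y)` on affine points and `φ (φ P) + φ P + P = 0` on `E(k̄)` (the latter by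
comparison with the explicit `[ω]` of `JZero.exists_cm_addEquiv_semilinear`). Silverman, *AEC*,
III.10.1. [cite: SilvermanAEC2009, Thm. III.10.1 and Cor. III.10.2] -/
theorem exists_cm_isogeny_of_eq {k : Type u} [Field k] [CharZero k] {V : WeierstrassCurve k}
    [V.IsElliptic] {B ζ : k} (hV : V = ⟨0, 0, 0, 0, B⟩) (hζ : IsPrimitiveRoot ζ 3) :
    ∃ φ : Isogeny V V,
      (∀ (x y : AlgebraicClosure k)
        (h : (V.baseChange (AlgebraicClosure k)).toAffine.Nonsingular x y),
        ∃ h', φ (Affine.Point.some x y h) =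
          Affine.Point.some (algebraMap k (AlgebraicClosure k) ζ ^ 2 * x) y h') ∧
      ∀ P, φ (φ P) + φ P + P = 0 := by
  subst hV
  have hζ0 : ζ ≠ 0 := hζ.ne_zero (by norm_num)
  have hζ3 : ζ ^ 3 = 1 := hζ.pow_eq_one
  have h6 : ζ ^ 6 * B = B := by
    rw [show ζ ^ 6 = (ζ ^ 3) ^ 2 by ring, hζ3]
    ring
  obtain ⟨φ, hφ⟩ :=
    exists_isogeny_apply_eq_of_pow_four_mul_eq_of_pow_six_mul_eq 0 B hζ0 (mul_zero _) h6
  set ζ' : AlgebraicClosure k := algebraMap k (AlgebraicClosure k) ζ ^ 2 with hζ'def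
  have hζ'3 : ζ' ^ 3 = 1 := by
    rw [hζ'def, ← pow_mul, show 2 * 3 = 3 * 2 by rfl, pow_mul, ← map_pow, hζ3, map_one, one_pow]
  have hζ'1 : ζ' ≠ 1 := by
    intro h1
    have h2 : ζ ^ 2 = 1 := by
      apply (algebraMap k (AlgebraicClosure k)).injective
      rw [map_pow, map_one]
      exact h1
    exact hζ.pow_ne_one_of_pos_of_lt (by norm_num) (by norm_num) h2
  have hφ' : ∀ (x y : AlgebraicClosure k)
      (h : ((⟨0, 0, 0, 0, B⟩ : WeierstrassCurve k).baseChange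
        (AlgebraicClosure k)).toAffine.Nonsingular x y),
      ∃ h', φ (Affine.Point.some x y h) = Affine.Point.some (ζ' * x) y h' := by
    intro x y h
    obtain ⟨h', e⟩ := hφ x y h
    have hy : algebraMap k (AlgebraicClosure k) ζ ^ 3 * y = y := by
      rw [← map_pow, hζ3, map_one, one_mul]
    refine ⟨?_, e.trans (Affine.Point.some_eq_some_of_eq rfl hy)⟩
    simpa only [hy] using h'
  refine ⟨φ, hφ', ?_⟩
  obtain ⟨ψ, hψ, -, -, h3⟩ := exists_cm_addEquiv_semilinear (W := (⟨0, 0, 0, 0, B⟩ :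
    WeierstrassCurve k)) rfl rfl rfl rfl hζ'3 hζ'1
  have hφψ : ∀ P, φ P = ψ P := by
    intro P
    change ((⟨0, 0, 0, 0, B⟩ : WeierstrassCurve k).baseChange (AlgebraicClosure k)).toAffine.Point
      at P
    rcases P with _ | ⟨x, y, h⟩
    · exact (map_zero φ).trans (map_zero ψ).symm
    · obtain ⟨h₁, e₁⟩ := hφ' x y h
      obtain ⟨h₂, e₂⟩ := hψ h
      exact e₁.trans e₂.symm
  intro P
  rw [hφψ, hφψ]
  exact h3 P

end JZero

/-! ## Functoriality of `H¹(K, E[n])` in an equivariant endomorphism of `E[n]` -/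

section TorsionOperator

variable {K : Type u} [Field K] {W : WeierstrassCurve K} (n : ℤ)

/-- **Compatibility with `H¹(K, E[n]) → H¹(K, E)`**: for an equivariant `fn : E[n] → E[n]` lying over
an equivariant `f : E(K̄) → E(K̄)`, `H¹(fn)` lies over `H¹(f)` (`galH1Map`): both paths
`H¹(K, E[n]) → H¹(K, E)` are the map of one compatible pair. Serre, *Galois Cohomology*, I.§2.4.
[cite: SerreGaloisCohomology1997, I.§2.4] -/
theorem torsionH1ToH1_resH1Hom_id (fn : geomTorsion W n →+ geomTorsion W n)
    (hfn : ∀ (σ : Field.absoluteGaloisGroup K) (P : geomTorsion W n),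
      fn (ContinuousMonoidHom.id _ σ • P) = σ • fn P)
    (f : W.geomPoints →+ W.geomPoints)
    (hf : ∀ (σ : Field.absoluteGaloisGroup K) (P : W.geomPoints), f (σ • P) = σ • f P)
    (hcoe : ∀ P : geomTorsion W n, ((fn P : geomTorsion W n) : W.geomPoints) = f P)
    (c : galH1Torsion W n) :
    torsionH1ToH1 W n (resH1Hom (ContinuousMonoidHom.id _) fn hfn c) =
      galH1Map f hf (torsionH1ToH1 W n c) := by
  have key : (resH1Hom (ContinuousMonoidHom.id (Field.absoluteGaloisGroup K))
      (geomTorsion W n).subtype (fun _ _ ↦ rfl)).comp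
        (resH1Hom (ContinuousMonoidHom.id _) fn hfn) =
      (galH1Map f hf).comp (resH1Hom (ContinuousMonoidHom.id (Field.absoluteGaloisGroup K))
        (geomTorsion W n).subtype (fun _ _ ↦ rfl)) := by
    unfold galH1Map
    rw [resH1Hom_comp, resH1Hom_comp]
    exact resH1Hom_congr rfl (by ext P; exact hcoe P) _ _
  exact congrArg (fun F : galH1Torsion W n →+ W.galH1 ↦ F c) key

/-- **A relation `f² + f + 1 = 0` on `E[n]` passes to `H¹(K, E[n])`**: with `w := H¹(fn)`,
`w (w c) + w c + c = 0` (on cocycles, `[fn ∘ fn ∘ a] + [fn ∘ a] + [a] = [(fn² + fn + 1) ∘ a] = 0`).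
Serre, *Galois Cohomology*, I.§2.4. [cite: SerreGaloisCohomology1997, I.§2.4] -/
theorem resH1Hom_id_apply_apply_add (fn : geomTorsion W n →+ geomTorsion W n)
    (hfn : ∀ (σ : Field.absoluteGaloisGroup K) (P : geomTorsion W n),
      fn (ContinuousMonoidHom.id _ σ • P) = σ • fn P)
    (h : ∀ P, fn (fn P) + fn P + P = 0) (c : galH1Torsion W n) :
    resH1Hom (ContinuousMonoidHom.id _) fn hfn (resH1Hom (ContinuousMonoidHom.id _) fn hfn c) +
      resH1Hom (ContinuousMonoidHom.id _) fn hfn c + c = 0 := by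
  obtain ⟨a, rfl⟩ := oneCocycleClass_surjective _ c
  rw [resH1Hom_id_oneCocycleClass, resH1Hom_id_oneCocycleClass, ← oneCocycleClass_add,
    ← oneCocycleClass_add]
  have h0 : contOneCocycles.push fn hfn (contOneCocycles.push fn hfn a) +
      contOneCocycles.push fn hfn a + a = 0 := by
    refine Subtype.ext (ContinuousMap.ext fun σ ↦ ?_)
    exact h (a.1 σ)
  rw [h0]
  exact map_zero (oneCocycleClassₗ _)

variable (E : Type u) [Field E] [Algebra K E]

/-- **`H¹(fn)` respects the local condition at `E`** when `f` has a local points map at `E`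
(`fE` equivariant with `fE ∘ ι = ι ∘ f`): both paths `H¹(K, E[n]) → H¹(E, E)` are the map of one
compatible pair (cf. `galH1Map_mem_localRestrictionKer`, `galH1PrimaryMap_mem_selmerLocalKerPrimary`).
Milne, *ADT*, I.§6. [cite: MilneADT2006, Ch. I §6 p. 75] -/
theorem resH1Hom_id_mem_selmerLocalKer (fn : geomTorsion W n →+ geomTorsion W n)
    (hfn : ∀ (σ : Field.absoluteGaloisGroup K) (P : geomTorsion W n),
      fn (ContinuousMonoidHom.id _ σ • P) = σ • fn P)
    (f : W.geomPoints →+ W.geomPoints)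
    (hcoe : ∀ P : geomTorsion W n, ((fn P : geomTorsion W n) : W.geomPoints) = f P)
    (fE : localPoints W E →+ localPoints W E)
    (hfE : ∀ (τ : Field.absoluteGaloisGroup E) (P : localPoints W E), fE (τ • P) = τ • fE P)
    (hcomp : ∀ P : W.geomPoints, fE (pointsMap W E P) = pointsMap W E (f P))
    {c : galH1Torsion W n} (hc : c ∈ selmerLocalKer W E n) :
    resH1Hom (ContinuousMonoidHom.id _) fn hfn c ∈ selmerLocalKer W E n := by
  rw [selmerLocalKer, resKer_eq_ker, AddMonoidHom.mem_ker] at hc ⊢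
  have key : (resH1Hom (resGal (K := K) E)
      ((pointsMap W E).comp (geomTorsion W n).subtype) (fun σ P ↦ by
        simp only [AddMonoidHom.coe_comp, AddSubgroup.coe_subtype, Function.comp_apply,
          AddSubgroup.torsionBy.coe_smul]
        exact pointsMap_smul W E σ P)).comp (resH1Hom (ContinuousMonoidHom.id _) fn hfn) =
      (resH1Hom (ContinuousMonoidHom.id (Field.absoluteGaloisGroup E)) fE hfE).comp
        (resH1Hom (resGal (K := K) E)
          ((pointsMap W E).comp (geomTorsion W n).subtype) (fun σ P ↦ by
            simp only [AddMonoidHom.coe_comp, AddSubgroup.coe_subtype, Function.comp_apply,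
              AddSubgroup.torsionBy.coe_smul]
            exact pointsMap_smul W E σ P)) := by
    rw [resH1Hom_comp, resH1Hom_comp]
    refine resH1Hom_congr (by ext; rfl) ?_ _ _
    ext P
    change pointsMap W E ((fn P : geomTorsion W n) : W.geomPoints) = fE (pointsMap W E P)
    rw [hcoe, hcomp]
  have hkey := congrArg (fun F : galH1Torsion W n →+ localH1 W E ↦ F c) key
  simp only [AddMonoidHom.comp_apply] at hkey
  rw [hkey, hc, map_zero]

end TorsionOperator

section TorsionOperatorNumberField

open NumberField IsDedekindDomain

variable {K : Type u} [Field K] [NumberField K] {W : WeierstrassCurve K} (n : ℤ)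

/-- **`H¹(fn) (Sel_n(E/K)) ⊆ Sel_n(E/K)`** for `fn` lying over an `f` with local points maps (every
isogeny over `K`: `Isogeny.hasLocalPointsMaps_toAddMonoidHom`): the local condition at every
finite and every infinite place is respected (`resH1Hom_id_mem_selmerLocalKer`). Milne, *ADT*,
I.§6–§7. [cite: MilneADT2006, Ch. I §6 p. 75] -/
theorem resH1Hom_id_mem_selmerGroup (fn : geomTorsion W n →+ geomTorsion W n)
    (hfn : ∀ (σ : Field.absoluteGaloisGroup K) (P : geomTorsion W n),
      fn (ContinuousMonoidHom.id _ σ • P) = σ • fn P)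
    (f : W.geomPoints →+ W.geomPoints)
    (hcoe : ∀ P : geomTorsion W n, ((fn P : geomTorsion W n) : W.geomPoints) = f P)
    (hloc : HasLocalPointsMaps W W f) {c : galH1Torsion W n} (hc : c ∈ selmerGroup W n) :
    resH1Hom (ContinuousMonoidHom.id _) fn hfn c ∈ selmerGroup W n := by
  rw [mem_selmerGroup_iff] at hc ⊢
  refine ⟨fun v ↦ ?_, fun w ↦ ?_⟩
  · obtain ⟨fE, hfE, hcomp⟩ := hloc (v.adicCompletion K)
    exact resH1Hom_id_mem_selmerLocalKer n _ fn hfn f hcoe fE hfE hcomp (hc.1 v)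
  · obtain ⟨fE, hfE, hcomp⟩ := hloc w.Completion
    exact resH1Hom_id_mem_selmerLocalKer n _ fn hfn f hcoe fE hfE hcomp (hc.2 w)

end TorsionOperatorNumberField

section TorsionOperatorLift

variable {K : Type u} [Field K] [CharZero K] (W : WeierstrassCurve ℚ) (n : ℤ)
variable {σ : K ≃ₐ[ℚ] K} {τ : AlgebraicClosure K ≃+* AlgebraicClosure K}

/-- **Commutation with the action of a lift.** For a lift `τ` of `σ ∈ Aut(K/ℚ)` and an
equivariant `fn : E_K[n] → E_K[n]` with `τ (fn P) = fn (fn (τ P))` on `E_K[n]` (SEMILINEARITY, as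
for `[ω]` when `σ ω = ω²`): `τ_* ∘ H¹(fn) = H¹(fn)² ∘ τ_*` on `H¹(K, E_K[n])` (both sides are maps of
one compatible pair). Gross 1991, §5. [cite: GrossLMS1991, §5 (5.1)]
[cite: SerreGaloisCohomology1997, I.§2.4] -/
theorem IsLiftOfAut.conjH1_resH1Hom_id (hτ : IsLiftOfAut σ τ)
    (fn : geomTorsion (W.baseChange K) n →+ geomTorsion (W.baseChange K) n)
    (hfn : ∀ (g : Field.absoluteGaloisGroup K) (P : geomTorsion (W.baseChange K) n),
      fn (ContinuousMonoidHom.id _ g • P) = g • fn P)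
    (hsemi : ∀ P : geomTorsion (W.baseChange K) n,
      hτ.torsionMap W n (fn P) = fn (fn (hτ.torsionMap W n P)))
    (c : galH1Torsion (W.baseChange K) n) :
    hτ.conjH1 W n (resH1Hom (ContinuousMonoidHom.id _) fn hfn c) =
      resH1Hom (ContinuousMonoidHom.id _) fn hfn
        (resH1Hom (ContinuousMonoidHom.id _) fn hfn (hτ.conjH1 W n c)) := by
  have key : (resH1Hom hτ.conjGalCMH (hτ.torsionMap W n) (hτ.torsionMap_smul W n)).comp
      (resH1Hom (ContinuousMonoidHom.id _) fn hfn) =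
      ((resH1Hom (ContinuousMonoidHom.id _) fn hfn).comp
        (resH1Hom (ContinuousMonoidHom.id _) fn hfn)).comp
        (resH1Hom hτ.conjGalCMH (hτ.torsionMap W n) (hτ.torsionMap_smul W n)) := by
    rw [resH1Hom_comp, resH1Hom_comp, resH1Hom_comp]
    refine resH1Hom_congr (by ext; rfl) ?_ _ _
    ext P
    exact congrArg Subtype.val (hsemi P)
  exact congrArg (fun F : galH1Torsion (W.baseChange K) n →+ galH1Torsion (W.baseChange K) n ↦
    F c) key

end TorsionOperatorLift

/-! ## The package on the tree's objects: `[ω]` on `H¹(K, E_K[n])` and `Sel_n(E_K/K)` -/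

namespace JZero

variable (K : Type) [Field K] [NumberField K] (W : WeierstrassCurve ℚ) [W.IsElliptic]

omit [W.IsElliptic] in
/-- `W.baseChange K` is again the short `j = 0` model `⟨0, 0, 0, 0, b⟩`. [folklore] -/
private theorem baseChange_eq_of_a_eq_zero' (ha₁ : W.a₁ = 0) (ha₂ : W.a₂ = 0) (ha₃ : W.a₃ = 0)
    (ha₄ : W.a₄ = 0) : W.baseChange K = ⟨0, 0, 0, 0, algebraMap ℚ K W.a₆⟩ := by
  ext
  · change algebraMap ℚ K W.a₁ = 0
    rw [ha₁, map_zero]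
  · change algebraMap ℚ K W.a₂ = 0
    rw [ha₂, map_zero]
  · change algebraMap ℚ K W.a₃ = 0
    rw [ha₃, map_zero]
  · change algebraMap ℚ K W.a₄ = 0
    rw [ha₄, map_zero]
  · rfl

/-- **`[ω]` on `H¹(K, E_K[n])` and `Sel_n(E_K/K)` — the `(M, w)` input of LEMMA D at finite level,
with its semilinearity.** For `E = W/ℚ` elliptic with `a₁ = … = a₄ = 0`, `K` a number field with a
primitive cube root of unity `ζ`, `σ ∈ Aut(K/ℚ)` with `σ ζ = ζ²`, and any `n : ℤ`: there are the
`K`-isogeny `φ = [ζ] : (x, y) ↦ (ζ² x, y)` of `E_K` with `φ² + φ + 1 = 0`, and an operator `w` on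
`H¹(K, E_K[n])` (`= H¹([ζ]|E[n])`) such that
(i) `w` lies over `H¹([ζ])` on `H¹(K, E_K)` (`torsionH1ToH1 ∘ w = galH1Map φ ∘ torsionH1ToH1`);
(ii) `w (w c) + w c + c = 0`;
(iii) `w` preserves `Sel_n(E_K/K)` (`selmerGroup`);
(iv) for EVERY lift `τ` of `σ`: `τ_* (w c) = w (w (τ_* c))` (`IsLiftOfAut.conjH1`), in particular for
the tree's `conjAct W σ n`; equivalently (v) `σ_* (w c) = −σ_* c − w (σ_* c)` — the hypothesis `hσw`
of `SylvesterTwoUnramifiedDescent.descent_bijective`. With `n = 2^M` this makes `Sel_{2^M}(E_K/K)`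
(and `H¹(K, E_K[2^M])`) a `(ℤ/2^M)[ω]`-module with a semilinear `Gal(K/ℚ)`-action, as used in the
memo's TAIL argument. Gross 1991, §5; Milne, *ADT*, I.§6; Silverman, *AEC*, III.10.1.
[cite: GrossLMS1991, §5 (5.1)] [cite: MilneADT2006, Ch. I §6 p. 75]
[cite: SilvermanAEC2009, Thm. III.10.1 and Cor. III.10.2] -/
theorem exists_cm_operator_galH1Torsion (ha₁ : W.a₁ = 0) (ha₂ : W.a₂ = 0) (ha₃ : W.a₃ = 0)
    (ha₄ : W.a₄ = 0) {ζ : K} (hζ : IsPrimitiveRoot ζ 3) {σ : K ≃ₐ[ℚ] K} (hσζ : σ ζ = ζ ^ 2)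
    (n : ℤ) :
    ∃ (φ : Isogeny (W.baseChange K) (W.baseChange K))
      (w : galH1Torsion (W.baseChange K) n →+ galH1Torsion (W.baseChange K) n),
      (∀ (x y : AlgebraicClosure K)
        (h : ((W.baseChange K).baseChange (AlgebraicClosure K)).toAffine.Nonsingular x y),
        ∃ h', φ (Affine.Point.some x y h) =
          Affine.Point.some (algebraMap K (AlgebraicClosure K) ζ ^ 2 * x) y h') ∧
      (∀ P, φ (φ P) + φ P + P = 0) ∧
      (∀ c, torsionH1ToH1 (W.baseChange K) n (w c) =
        galH1Map φ.toAddMonoidHom φ.equivariant (torsionH1ToH1 (W.baseChange K) n c)) ∧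
      (∀ c, w (w c) + w c + c = 0) ∧
      (∀ c ∈ selmerGroup (W.baseChange K) n, w c ∈ selmerGroup (W.baseChange K) n) ∧
      (∀ {τ : AlgebraicClosure K ≃+* AlgebraicClosure K} (hτ : IsLiftOfAut σ τ) (c),
        hτ.conjH1 W n (w c) = w (w (hτ.conjH1 W n c))) ∧
      (∀ c, conjAct W σ n (w c) = w (w (conjAct W σ n c))) ∧
      ∀ c, conjAct W σ n (w c) = -(conjAct W σ n c) - w (conjAct W σ n c) := by
  obtain ⟨φ, hφ, hrel⟩ := exists_cm_isogeny_of_eq (V := W.baseChange K)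
    (baseChange_eq_of_a_eq_zero' K W ha₁ ha₂ ha₃ ha₄) hζ
  -- the restriction of `φ` to `E[n]`
  let fn : geomTorsion (W.baseChange K) n →+ geomTorsion (W.baseChange K) n :=
    (φ.toAddMonoidHom.comp (geomTorsion (W.baseChange K) n).subtype).codRestrict _ fun P ↦ by
      simp only [AddMonoidHom.coe_comp, AddSubgroup.coe_subtype, Function.comp_apply]
      rw [mem_geomTorsion_iff, ← map_zsmul, (mem_geomTorsion_iff _ n _).mp P.2, map_zero]
  have hcoe : ∀ P : geomTorsion (W.baseChange K) n,
      ((fn P : geomTorsion (W.baseChange K) n) : geomPoints (W.baseChange K)) = φ P :=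
    fun _ ↦ rfl
  have hfn : ∀ (g : Field.absoluteGaloisGroup K) (P : geomTorsion (W.baseChange K) n),
      fn (ContinuousMonoidHom.id _ g • P) = g • fn P := by
    intro g P
    apply Subtype.ext
    rw [hcoe, AddSubgroup.torsionBy.coe_smul, AddSubgroup.torsionBy.coe_smul, hcoe]
    exact φ.equivariant g P
  have hreln : ∀ P : geomTorsion (W.baseChange K) n, fn (fn P) + fn P + P = 0 := by
    intro P
    apply Subtype.ext
    change ((fn (fn P) : geomTorsion (W.baseChange K) n) : geomPoints (W.baseChange K)) +
      ((fn P : geomTorsion (W.baseChange K) n) : geomPoints (W.baseChange K)) + P = 0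
    exact hrel P
  -- semilinearity on points, for any lift
  have hsemiPts : ∀ {τ : AlgebraicClosure K ≃+* AlgebraicClosure K} (hτ : IsLiftOfAut σ τ)
      (P : geomPoints (W.baseChange K)), hτ.pointsMap W (φ P) = φ (φ (hτ.pointsMap W P)) := by
    intro τ hτ P
    change ((W.baseChange K).baseChange (AlgebraicClosure K)).toAffine.Point at P
    rcases P with _ | ⟨x, y, h⟩
    · change hτ.pointsMap W (φ 0) = φ (φ (hτ.pointsMap W 0))
      rw [map_zero, map_zero, map_zero, map_zero]
    · obtain ⟨h₁, e₁⟩ := hφ x y h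
      obtain ⟨h₂, e₂⟩ := hτ.pointsMap_some W h₁
      obtain ⟨h₃, e₃⟩ := hτ.pointsMap_some W h
      obtain ⟨h₄, e₄⟩ := hφ _ _ h₃
      obtain ⟨h₅, e₅⟩ := hφ _ _ h₄
      have eL : hτ.pointsMap W (φ (Affine.Point.some x y h)) =
          (show geomPoints (W.baseChange K) from
            .some (τ (algebraMap K (AlgebraicClosure K) ζ ^ 2 * x)) (τ y) h₂) := by
        rw [e₁]; exact e₂
      have eR : φ (φ (hτ.pointsMap W (Affine.Point.some x y h))) =
          Affine.Point.some (algebraMap K (AlgebraicClosure K) ζ ^ 2 *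
            (algebraMap K (AlgebraicClosure K) ζ ^ 2 * τ x)) (τ y) h₅ := by
        rw [e₃]
        change φ (φ (Affine.Point.some (τ x) (τ y) h₃)) = _
        rw [e₄, e₅]
      refine eL.trans (Eq.trans ?_ eR.symm)
      refine Affine.Point.some_eq_some_of_eq ?_ rfl
      rw [map_mul, map_pow, hτ ζ, hσζ, map_pow]
      ring
  have hsemi : ∀ {τ : AlgebraicClosure K ≃+* AlgebraicClosure K} (hτ : IsLiftOfAut σ τ)
      (P : geomTorsion (W.baseChange K) n),
      hτ.torsionMap W n (fn P) = fn (fn (hτ.torsionMap W n P)) := by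
    intro τ hτ P
    apply Subtype.ext
    rw [IsLiftOfAut.coe_torsionMap, hcoe, hcoe, hcoe, IsLiftOfAut.coe_torsionMap]
    exact hsemiPts hτ P
  refine ⟨φ, resH1Hom (ContinuousMonoidHom.id _) fn hfn, hφ, hrel,
    torsionH1ToH1_resH1Hom_id n fn hfn φ.toAddMonoidHom φ.equivariant hcoe,
    resH1Hom_id_apply_apply_add n fn hfn hreln,
    fun c hc ↦ resH1Hom_id_mem_selmerGroup n fn hfn φ.toAddMonoidHom hcoe
      φ.hasLocalPointsMaps_toAddMonoidHom hc,
    fun hτ c ↦ IsLiftOfAut.conjH1_resH1Hom_id W n hτ fn hfn (hsemi hτ) c, fun c ↦ ?_, fun c ↦ ?_⟩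
  · exact IsLiftOfAut.conjH1_resH1Hom_id W n (isLiftOfAut_liftAut σ) fn hfn
      (hsemi (isLiftOfAut_liftAut σ)) c
  · have e := IsLiftOfAut.conjH1_resH1Hom_id W n (isLiftOfAut_liftAut σ) fn hfn
      (hsemi (isLiftOfAut_liftAut σ)) c
    have r := resH1Hom_id_apply_apply_add n fn hfn hreln (conjAct W σ n c)
    change conjAct W σ n _ = _ at e
    rw [e]
    change resH1Hom (ContinuousMonoidHom.id _) fn hfn
        (resH1Hom (ContinuousMonoidHom.id _) fn hfn (conjAct W σ n c)) = _
    rw [eq_sub_iff_add_eq, eq_neg_iff_add_eq_zero]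
    rw [add_assoc, add_comm (resH1Hom _ fn hfn (conjAct W σ n c)), ← add_assoc] at r
    -- `r : w (w s) + s + w s = 0`; goal: `w (w s) + w s + s = 0`
    rw [add_assoc, add_comm (resH1Hom _ fn hfn (conjAct W σ n c)), ← add_assoc]
    exact r

end JZero

end Literature.NumberTheory.EllipticCurves
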